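import Literature.Probability.LatticeModels.LatticePotentialKernelConstant
import HarnessLib

/-!
# Quantitative asymptotics of the planar potential kernel:
# `|a(x) - (1/π) log |x| - (2γ + 3 log 2)/(2π)| ≤ C/|x|`

Topic `Literature/Probability/LatticeModels`; the quantitative form of
`LatticePotentialKernelAsymptotics.lean` (`a(x) - (2π)⁻¹ log(x₀² + x₁²) → κ`, Lawler–Limic 2010,
Thm. 4.4.4 in the normalisation `Δ a = 2δ₀`) and `LatticePotentialKernelConstant.lean`
(`κ = k₀/2`, `k₀ = KozdronLawler.greenConst = (2γ + 3 log 2)/π`):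

* `latticePotentialKernel_two_rate` — **there is `C` with
  `|a(x) - (1/π) log ‖x‖ - k₀/2| ≤ C/‖x‖` for every `x ≠ 0` in `ℤ²`** (`‖x‖` the modulus of
  `Site.toComplex x`).

This is the form of eq. (16) of Kozdron–Lawler 2005 ("`a(x) = (2/π) log|x| + k₀ + o(|x|^{-3/2})`
… "the error above will suffice for our purposes") consumed by the printed proof of their
Theorem 1.2 (`GreenFunctionConformalRadius.lean`): a POWER rate is needed there (only the rate
`|x|⁻¹` is proved here; Lawler–Limic's `O(|x|⁻²)` would require the next term of the local limit
theorem).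

Proof: the decomposition of `LatticePotentialKernelAsymptotics.lean` is repeated with its error
terms kept explicit — `a(x) - (2π)⁻¹ log s = (C₀ - I₁) + (C₁ - I₂) + (2π)⁻¹(F(s/2) - log(s/2)) -
(2π)⁻¹ log 2`, `s = x₀² + x₁²`, with `|I₁| ≤ A²(1+s)⁻¹` (`srwHeatKernel_decay` on `(0,1]`),
`|I₂| ≤ B(A+C)/√s` (`srwHeatKernel_lclt` on `(1,∞)`), and the new ingredient
`0 ≤ F(σ) - log σ - L ≤ 1/σ` (`logIntegral_sub_log_sub_const`: the difference is
`∫₀^{1/σ} e^{-1/u} du/u` with integrand in `[0,1]`); the resulting limit constant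
`C₀ + C₁ + (2π)⁻¹(L - log 2)` is then identified with `k₀/2` by uniqueness of limits
(`latticePotentialKernel_two_tendsto_greenConst`), and the finitely many `x ≠ 0` with `s < 2`
are absorbed in the constant. No named fact is introduced.

## References

* G. F. Lawler, V. Limic, *Random Walk: A Modern Introduction* (2010), Thm. 4.4.4 [LawlerLimic2010].
* M. J. Kozdron, G. F. Lawler, Electron. J. Probab. 10 (2005), §2.3 eq. (16) [KozdronLawler2005].
-/

noncomputable section

open MeasureTheory Set Filter Real
open _root_.Topology

namespace Literature.Probability.LatticeModels

/-! ### The logarithmic integral with a rate -/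

/-- **`0 ≤ F(σ) - log σ - L ≤ 1/σ`** for `σ ≥ 1`: by `logIntegral_sub_log_eq` the difference is
`∫₀^{1/σ} e^{-1/u} du/u`, whose integrand lies in `[0, 1]`. [folklore] -/
theorem logIntegral_sub_log_sub_const {σ : ℝ} (hσ : 1 ≤ σ) :
    0 ≤ logIntegral σ - Real.log σ - logIntegralConst ∧
      logIntegral σ - Real.log σ - logIntegralConst ≤ σ⁻¹ := by
  have hσ0 : 0 < σ := by linarith
  have hinv0 : 0 < σ⁻¹ := inv_pos.2 hσ0
  have hinv1 : σ⁻¹ ≤ 1 := inv_le_one_of_one_le₀ hσ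
  have hint : IntegrableOn logTailIntegrand (Ioc (0 : ℝ) 1) := integrableOn_logTailIntegrand
  have hsplit : ∫ u in Ioc (0 : ℝ) 1, logTailIntegrand u =
      (∫ u in Ioc (0 : ℝ) σ⁻¹, logTailIntegrand u) + ∫ u in Ioc σ⁻¹ 1, logTailIntegrand u := by
    rw [← setIntegral_union (Ioc_disjoint_Ioc_of_le le_rfl) measurableSet_Ioc
      (hint.mono_set (Ioc_subset_Ioc_right hinv1)) (hint.mono_set (Ioc_subset_Ioc_left hinv0.le)),
      Ioc_union_Ioc_eq_Ioc hinv0.le hinv1]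
  have heq : logIntegral σ - Real.log σ - logIntegralConst = ∫ u in Ioc (0 : ℝ) σ⁻¹, logTailIntegrand u := by
    rw [logIntegral_sub_log_eq hσ, logIntegralConst, hsplit]
    ring
  rw [heq]
  refine ⟨setIntegral_nonneg measurableSet_Ioc fun u hu => (logTailIntegrand_nonneg_and_le_one hu.1).1, ?_⟩
  have hb : ∀ u ∈ Ioc (0 : ℝ) σ⁻¹, ‖logTailIntegrand u‖ ≤ 1 := fun u hu => by
    rw [Real.norm_eq_abs, abs_of_nonneg (logTailIntegrand_nonneg_and_le_one hu.1).1]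
    exact (logTailIntegrand_nonneg_and_le_one hu.1).2
  have h := norm_setIntegral_le_of_norm_le_const (show volume (Ioc (0 : ℝ) σ⁻¹) < ⊤ from measure_Ioc_lt_top) hb
  rw [Real.volume_real_Ioc_of_le hinv0.le, sub_zero, one_mul, Real.norm_eq_abs] at h
  exact (le_abs_self _).trans h

/-! ### The rate -/

/-- **Quantitative asymptotics of the planar potential kernel** (Lawler–Limic 2010, Thm. 4.4.4
with the rate `|x|⁻¹`; Kozdron–Lawler 2005, eq. (16)): in the normalisation `Δ a = 2δ₀` there is
`C` with `|a(x) - (1/π) log ‖x‖ - k₀/2| ≤ C/‖x‖` for all `x ≠ 0`, `k₀ = (2γ + 3 log 2)/π`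
(`KozdronLawler.greenConst`), `‖x‖` the modulus of `Site.toComplex x`.
[cite: LawlerLimic2010, Thm. 4.4.4] -/
theorem latticePotentialKernel_two_rate : ∃ C : ℝ, ∀ x : Site 2, x ≠ 0 →
    |latticePotentialKernel 2 x - 1 / π * Real.log ‖Site.toComplex x‖ - KozdronLawler.greenConst / 2| ≤
      C / ‖Site.toComplex x‖ := by
  obtain ⟨A, hA0, hA⟩ := srwHeatKernel_decay 1
  obtain ⟨B, hB0, hB⟩ := srwHeatKernel_lclt 1
  set C : ℝ := 2 * Real.exp (1 / 2) with hC
  have hC0 : 0 < C := by positivity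
  have hπ := Real.pi_pos
  -- the pieces (as in `LatticePotentialKernelAsymptotics.lean`)
  set C₀ : ℝ := ∫ t in Ioc (0 : ℝ) 1, srwHeatKernel t 0 ^ 2 with hC₀
  set C₁ : ℝ := ∫ t in Ioi (1 : ℝ), (srwHeatKernel t 0 ^ 2 - gaussHeatKernel t 0 ^ 2) with hC₁
  set κ : ℝ := C₀ + C₁ + (2 * π)⁻¹ * (logIntegralConst - Real.log 2) with hκ
  set s : Site 2 → ℝ := fun x => ((x 0 : ℤ) : ℝ) ^ 2 + ((x 1 : ℤ) : ℝ) ^ 2 with hs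
  set I₁ : Site 2 → ℝ := fun x => ∫ t in Ioc (0 : ℝ) 1, srwHeatKernel t (x 0) * srwHeatKernel t (x 1) with hI₁
  set I₂ : Site 2 → ℝ := fun x =>
    ∫ t in Ioi (1 : ℝ), (srwHeatKernel t (x 0) * srwHeatKernel t (x 1) - gaussHeatKernel t (x 0) * gaussHeatKernel t (x 1)) with hI₂
  have hs0 : ∀ x, 0 ≤ s x := fun x => by positivity
  have hs1 : ∀ x : Site 2, x ≠ 0 → 1 ≤ s x := by
    intro x hx
    have h : x 0 ≠ 0 ∨ x 1 ≠ 0 := by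
      by_contra hc
      push Not at hc
      exact hx (by ext i; fin_cases i <;> simp [hc.1, hc.2])
    have hsq : ∀ z : ℤ, z ≠ 0 → (1 : ℝ) ≤ (z : ℝ) ^ 2 := fun z hz => by
      have h1 : 1 ≤ |z| := Int.one_le_abs hz
      have h2 : (1 : ℝ) ≤ |(z : ℝ)| := by exact_mod_cast h1
      nlinarith [abs_nonneg (z : ℝ), sq_abs (z : ℝ)]
    show (1 : ℝ) ≤ ((x 0 : ℤ) : ℝ) ^ 2 + ((x 1 : ℤ) : ℝ) ^ 2
    rcases h with h0 | h1
    · nlinarith [hsq _ h0, sq_nonneg ((x 1 : ℤ) : ℝ)]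
    · nlinarith [hsq _ h1, sq_nonneg ((x 0 : ℤ) : ℝ)]
  have hsnorm : ∀ x : Site 2, s x = ‖Site.toComplex x‖ ^ 2 := fun x => sq_add_sq_eq_norm_toComplex_sq x
  have hsqrt : ∀ x : Site 2, Real.sqrt (s x) = ‖Site.toComplex x‖ := fun x => by
    rw [hsnorm, Real.sqrt_sq (norm_nonneg _)]
  have hstend : Tendsto s cofinite atTop := tendsto_sum_sq_cofinite
  -- pointwise kernel facts
  have hq1 : ∀ t : ℝ, 0 ≤ t → ∀ m : ℤ, |srwHeatKernel t m| ≤ 1 := fun t ht m => abs_srwHeatKernel_le_one ht m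
  have hqA : ∀ t : ℝ, 1 ≤ t → ∀ m : ℤ, |srwHeatKernel t m| ≤ A * t ^ (-(1 / 2 : ℝ)) * ((1 + (m : ℝ) ^ 2 / t) ^ 1)⁻¹ := by
    intro t ht m
    have h := hA t (by linarith) m
    rwa [max_eq_right ht] at h
  have hφC : ∀ t : ℝ, 0 < t → ∀ m : ℝ, |gaussHeatKernel t m| ≤ C * t ^ (-(1 / 2 : ℝ)) * ((1 + m ^ 2 / t) ^ 1)⁻¹ := by
    intro t ht m
    rw [abs_of_nonneg (gaussHeatKernel_nonneg t m)]
    exact gaussHeatKernel_le_weight_one ht m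
  -- the product bound on `(1, ∞)`: `|q q - φ φ| ≤ B(A+C) t⁻² w₀ w₁`
  have hprod : ∀ t : ℝ, 1 ≤ t → ∀ a b : ℤ,
      |srwHeatKernel t a * srwHeatKernel t b - gaussHeatKernel t a * gaussHeatKernel t b| ≤ B * (A + C) * t ^ (-(2 : ℝ)) *
        (((1 + (a : ℝ) ^ 2 / t) ^ 1)⁻¹ * ((1 + (b : ℝ) ^ 2 / t) ^ 1)⁻¹) := by
    intro t ht a b
    have ht0 : 0 < t := by linarith
    have hda := hB t ht a
    have hdb := hB t ht b
    have hqb := hqA t ht b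
    have hφa := hφC t ht0 a
    have hw0 : 0 ≤ ((1 + (a : ℝ) ^ 2 / t) ^ 1)⁻¹ := by positivity
    have hw1 : 0 ≤ ((1 + (b : ℝ) ^ 2 / t) ^ 1)⁻¹ := by positivity
    have ht32 : 0 ≤ t ^ (-(3 / 2 : ℝ)) := Real.rpow_nonneg ht0.le _
    have ht12 : 0 ≤ t ^ (-(1 / 2 : ℝ)) := Real.rpow_nonneg ht0.le _
    have hpow : t ^ (-(3 / 2 : ℝ)) * t ^ (-(1 / 2 : ℝ)) = t ^ (-(2 : ℝ)) := by
      rw [← Real.rpow_add ht0]; norm_num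
    calc |srwHeatKernel t a * srwHeatKernel t b - gaussHeatKernel t a * gaussHeatKernel t b|
        = |(srwHeatKernel t a - gaussHeatKernel t a) * srwHeatKernel t b + gaussHeatKernel t a * (srwHeatKernel t b - gaussHeatKernel t b)| := by ring_nf
      _ ≤ |srwHeatKernel t a - gaussHeatKernel t a| * |srwHeatKernel t b| + |gaussHeatKernel t a| * |srwHeatKernel t b - gaussHeatKernel t b| := by
          refine (abs_add_le _ _).trans ?_
          rw [abs_mul, abs_mul]
      _ ≤ (B * t ^ (-(3 / 2 : ℝ)) * ((1 + (a : ℝ) ^ 2 / t) ^ 1)⁻¹) *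
            (A * t ^ (-(1 / 2 : ℝ)) * ((1 + (b : ℝ) ^ 2 / t) ^ 1)⁻¹) +
          (C * t ^ (-(1 / 2 : ℝ)) * ((1 + (a : ℝ) ^ 2 / t) ^ 1)⁻¹) *
            (B * t ^ (-(3 / 2 : ℝ)) * ((1 + (b : ℝ) ^ 2 / t) ^ 1)⁻¹) :=
          add_le_add (mul_le_mul hda hqb (abs_nonneg _) (mul_nonneg (mul_nonneg hB0.le ht32) hw0))
            (mul_le_mul hφa hdb (abs_nonneg _) (mul_nonneg (mul_nonneg hC0.le ht12) hw0))
      _ = B * (A + C) * (t ^ (-(3 / 2 : ℝ)) * t ^ (-(1 / 2 : ℝ))) *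
            (((1 + (a : ℝ) ^ 2 / t) ^ 1)⁻¹ * ((1 + (b : ℝ) ^ 2 / t) ^ 1)⁻¹) := by ring
      _ = _ := by rw [hpow]
  -- integrability of the pieces
  have hIoc_int : ∀ a b : ℤ, IntegrableOn (fun t => srwHeatKernel t a * srwHeatKernel t b) (Ioc (0 : ℝ) 1) := by
    intro a b
    refine Measure.integrableOn_of_bounded (measure_Ioc_lt_top (a := (0 : ℝ)) (b := 1)).ne
      (((continuous_srwHeatKernel_left a).mul (continuous_srwHeatKernel_left b)).aestronglyMeasurable)
      (M := 1) ?_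
    filter_upwards [ae_restrict_mem measurableSet_Ioc] with t ht
    rw [Real.norm_eq_abs, abs_mul]
    calc |srwHeatKernel t a| * |srwHeatKernel t b| ≤ 1 * 1 :=
          mul_le_mul (hq1 t ht.1.le a) (hq1 t ht.1.le b) (abs_nonneg _) zero_le_one
      _ = 1 := one_mul 1
  have hrpow2 : IntegrableOn (fun t : ℝ => t ^ (-(2 : ℝ))) (Ioi 1) :=
    integrableOn_Ioi_rpow_of_lt (by norm_num) one_pos
  have hmeas_diff : ∀ a b : ℤ, AEStronglyMeasurable (fun t => srwHeatKernel t a * srwHeatKernel t b - gaussHeatKernel t a * gaussHeatKernel t b)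
      (volume.restrict (Ioi (1 : ℝ))) := by
    intro a b
    refine (ContinuousOn.aestronglyMeasurable ?_ measurableSet_Ioi)
    refine ((continuous_srwHeatKernel_left a).mul (continuous_srwHeatKernel_left b)).continuousOn.sub ?_
    exact ((continuousOn_gaussHeatKernel_left a).mul (continuousOn_gaussHeatKernel_left b)).mono
      (Ioi_subset_Ioi zero_le_one)
  have hIoi_int : ∀ a b : ℤ, IntegrableOn (fun t => srwHeatKernel t a * srwHeatKernel t b - gaussHeatKernel t a * gaussHeatKernel t b) (Ioi (1 : ℝ)) := by
    intro a b
    refine (hrpow2.const_mul (B * (A + C))).mono' (hmeas_diff a b) ?_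
    filter_upwards [ae_restrict_mem measurableSet_Ioi] with t ht
    have ht1 : 1 ≤ t := le_of_lt ht
    have ht0 : 0 < t := by linarith
    rw [Real.norm_eq_abs]
    refine (hprod t ht1 a b).trans ?_
    have hw : ((1 + (a : ℝ) ^ 2 / t) ^ 1)⁻¹ * ((1 + (b : ℝ) ^ 2 / t) ^ 1)⁻¹ ≤ 1 :=
      mul_le_one₀ (weight_le_one ht0 a) (by positivity) (weight_le_one ht0 b)
    have h0 : 0 ≤ B * (A + C) * t ^ (-(2 : ℝ)) := by positivity
    calc B * (A + C) * t ^ (-(2 : ℝ)) * (((1 + (a : ℝ) ^ 2 / t) ^ 1)⁻¹ * ((1 + (b : ℝ) ^ 2 / t) ^ 1)⁻¹)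
        ≤ B * (A + C) * t ^ (-(2 : ℝ)) * 1 := by gcongr
      _ = B * (A + C) * t ^ (-(2 : ℝ)) := mul_one _
  have hlog_int : ∀ σ : ℝ, 0 ≤ σ → IntegrableOn (fun t : ℝ => (1 - Real.exp (-(σ / t))) / t) (Ioi 1) := by
    intro σ hσ
    refine (hrpow2.const_mul σ).mono' ?_ ?_
    · refine ContinuousOn.aestronglyMeasurable ?_ measurableSet_Ioi
      refine ContinuousOn.div ?_ continuousOn_id fun t ht => ne_of_gt (zero_lt_one.trans ht)
      exact continuousOn_const.sub (Real.continuous_exp.comp_continuousOn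
        ((continuousOn_const.div continuousOn_id fun t ht => ne_of_gt (zero_lt_one.trans ht)).neg))
    · filter_upwards [ae_restrict_mem measurableSet_Ioi] with t ht
      have ht0 : 0 < t := zero_lt_one.trans ht
      have h1 : 0 ≤ 1 - Real.exp (-(σ / t)) := by
        rw [sub_nonneg, Real.exp_le_one_iff, neg_nonpos]; positivity
      have h2 : 1 - Real.exp (-(σ / t)) ≤ σ / t := by
        have := Real.add_one_le_exp (-(σ / t)); linarith
      rw [Real.norm_eq_abs, abs_of_nonneg (div_nonneg h1 ht0.le), div_le_iff₀ ht0]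
      calc 1 - Real.exp (-(σ / t)) ≤ σ / t := h2
        _ = σ * t ^ (-(2 : ℝ)) * t := by
            rw [Real.rpow_neg ht0.le, show (2 : ℝ) = (2 : ℕ) by norm_num, Real.rpow_natCast]
            field_simp
  have hgauss_int : ∀ a b : ℤ, IntegrableOn (fun t => gaussHeatKernel t 0 ^ 2 - gaussHeatKernel t a * gaussHeatKernel t b) (Ioi (1 : ℝ)) := by
    intro a b
    have h : IntegrableOn (fun t : ℝ => (2 * π)⁻¹ *
        ((1 - Real.exp (-((((a : ℝ) ^ 2 + (b : ℝ) ^ 2) / 2) / t))) / t)) (Ioi 1) :=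
      (hlog_int (((a : ℝ) ^ 2 + (b : ℝ) ^ 2) / 2) (by positivity)).const_mul (2 * π)⁻¹
    refine h.congr_fun (fun t ht => ?_) measurableSet_Ioi
    exact (gaussHeatKernel_sq_sub_mul (zero_lt_one.trans ht) a b).symm
  have hq0_int : IntegrableOn (fun t => srwHeatKernel t 0 ^ 2 - gaussHeatKernel t 0 ^ 2) (Ioi (1 : ℝ)) := by
    have h := hIoi_int 0 0
    simpa only [Int.cast_zero, pow_two] using h
  -- the decomposition, for `x ≠ 0`
  have hdecomp : ∀ x : Site 2, x ≠ 0 →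
      latticePotentialKernel 2 x - (2 * π)⁻¹ * Real.log (s x) =
        (C₀ - I₁ x) + (C₁ - I₂ x) + (2 * π)⁻¹ * (logIntegral (s x / 2) - Real.log (s x / 2)) -
          (2 * π)⁻¹ * Real.log 2 := by
    intro x hx
    have hsx : 0 < s x := by linarith [hs1 x hx]
    obtain ⟨hDint, hDval⟩ := latticePotentialKernel_two_eq_integral x
    rw [hDval]
    have hsplit : ∫ t in Ioi (0 : ℝ), (srwHeatKernel t 0 ^ 2 - srwHeatKernel t (x 0) * srwHeatKernel t (x 1)) =
        (∫ t in Ioc (0 : ℝ) 1, (srwHeatKernel t 0 ^ 2 - srwHeatKernel t (x 0) * srwHeatKernel t (x 1))) +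
          ∫ t in Ioi (1 : ℝ), (srwHeatKernel t 0 ^ 2 - srwHeatKernel t (x 0) * srwHeatKernel t (x 1)) := by
      rw [← setIntegral_union Set.Ioc_disjoint_Ioi_same measurableSet_Ioi
        (hDint.mono_set Set.Ioc_subset_Ioi_self) (hDint.mono_set (Set.Ioi_subset_Ioi zero_le_one)),
        Set.Ioc_union_Ioi_eq_Ioi zero_le_one]
    have hsmall : ∫ t in Ioc (0 : ℝ) 1, (srwHeatKernel t 0 ^ 2 - srwHeatKernel t (x 0) * srwHeatKernel t (x 1)) = C₀ - I₁ x := by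
      have h00 := hIoc_int 0 0
      simp_rw [← pow_two] at h00
      rw [integral_sub h00 (hIoc_int (x 0) (x 1))]
    have hlarge : ∫ t in Ioi (1 : ℝ), (srwHeatKernel t 0 ^ 2 - srwHeatKernel t (x 0) * srwHeatKernel t (x 1)) =
        C₁ - I₂ x + ∫ t in Ioi (1 : ℝ), (gaussHeatKernel t 0 ^ 2 - gaussHeatKernel t (x 0) * gaussHeatKernel t (x 1)) := by
      have hpt : ∀ t : ℝ, srwHeatKernel t 0 ^ 2 - srwHeatKernel t (x 0) * srwHeatKernel t (x 1) =
          ((srwHeatKernel t 0 ^ 2 - gaussHeatKernel t 0 ^ 2) - (srwHeatKernel t (x 0) * srwHeatKernel t (x 1) - gaussHeatKernel t (x 0) * gaussHeatKernel t (x 1))) +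
            (gaussHeatKernel t 0 ^ 2 - gaussHeatKernel t (x 0) * gaussHeatKernel t (x 1)) := fun t => by ring
      simp_rw [hpt]
      have hint1 : IntegrableOn (fun t : ℝ => (srwHeatKernel t 0 ^ 2 - gaussHeatKernel t 0 ^ 2) -
          (srwHeatKernel t (x 0) * srwHeatKernel t (x 1) -
            gaussHeatKernel t (x 0) * gaussHeatKernel t (x 1))) (Ioi 1) :=
        hq0_int.sub (hIoi_int (x 0) (x 1))
      rw [integral_add hint1 (hgauss_int (x 0) (x 1)), integral_sub hq0_int (hIoi_int (x 0) (x 1))]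
    have hmain : ∫ t in Ioi (1 : ℝ), (gaussHeatKernel t 0 ^ 2 - gaussHeatKernel t (x 0) * gaussHeatKernel t (x 1)) =
        (2 * π)⁻¹ * logIntegral (s x / 2) := by
      rw [logIntegral, ← integral_const_mul]
      refine setIntegral_congr_fun measurableSet_Ioi fun t ht => ?_
      rw [gaussHeatKernel_sq_sub_mul (zero_lt_one.trans ht)]
    rw [hsplit, hsmall, hlarge, hmain, Real.log_div hsx.ne' two_ne_zero]
    ring
  -- `|I₁ x| ≤ A² (1 + s x)⁻¹`
  have hI₁ : ∀ x : Site 2, |I₁ x| ≤ A ^ 2 * (1 + s x)⁻¹ := by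
    intro x
    have hb : ∀ t ∈ Ioc (0 : ℝ) 1, ‖srwHeatKernel t (x 0) * srwHeatKernel t (x 1)‖ ≤ A ^ 2 * (1 + s x)⁻¹ := by
      intro t ht
      have h0 := hA t ht.1 (x 0)
      have h1 := hA t ht.1 (x 1)
      rw [max_eq_left ht.2, Real.one_rpow, mul_one, div_one] at h0 h1
      rw [Real.norm_eq_abs, abs_mul]
      have hw : ((1 + ((x 0 : ℤ) : ℝ) ^ 2) ^ 1)⁻¹ * ((1 + ((x 1 : ℤ) : ℝ) ^ 2) ^ 1)⁻¹ ≤ (1 + s x)⁻¹ := by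
        have := weight_mul_weight_le one_pos ((x 0 : ℤ) : ℝ) ((x 1 : ℤ) : ℝ)
        simp only [div_one] at this
        exact this
      calc |srwHeatKernel t (x 0)| * |srwHeatKernel t (x 1)|
          ≤ (A * ((1 + ((x 0 : ℤ) : ℝ) ^ 2) ^ 1)⁻¹) * (A * ((1 + ((x 1 : ℤ) : ℝ) ^ 2) ^ 1)⁻¹) :=
            mul_le_mul h0 h1 (abs_nonneg _) (mul_nonneg hA0.le (by positivity))
        _ = A ^ 2 * (((1 + ((x 0 : ℤ) : ℝ) ^ 2) ^ 1)⁻¹ * ((1 + ((x 1 : ℤ) : ℝ) ^ 2) ^ 1)⁻¹) := by ring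
        _ ≤ A ^ 2 * (1 + s x)⁻¹ := by gcongr
    have h := norm_setIntegral_le_of_norm_le_const
      (show volume (Ioc (0 : ℝ) 1) < ⊤ from measure_Ioc_lt_top) hb
    rw [Real.volume_real_Ioc_of_le zero_le_one, sub_zero, mul_one, Real.norm_eq_abs] at h
    exact h
  -- `|I₂ x| ≤ B(A+C)/√(s x)`
  have hI₂ : ∀ x : Site 2, x ≠ 0 → |I₂ x| ≤ B * (A + C) / Real.sqrt (s x) := by
    have hrpow32 : IntegrableOn (fun t : ℝ => t ^ (-(3 / 2 : ℝ))) (Ioi 1) :=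
      integrableOn_Ioi_rpow_of_lt (by norm_num) one_pos
    have hval32 : ∫ t in Ioi (1 : ℝ), t ^ (-(3 / 2 : ℝ)) = 2 := by
      rw [integral_Ioi_rpow_of_lt (by norm_num) one_pos]
      norm_num
    intro x hx
    have hsx : 0 < s x := by linarith [hs1 x hx]
    have hsq : 0 < Real.sqrt (s x) := Real.sqrt_pos.2 hsx
    set c : ℝ := B * (A + C) / (2 * Real.sqrt (s x)) with hc
    have hc0 : 0 ≤ c := by positivity
    have hb : ∀ᵐ t ∂(volume.restrict (Ioi (1 : ℝ))),
        ‖srwHeatKernel t (x 0) * srwHeatKernel t (x 1) - gaussHeatKernel t (x 0) * gaussHeatKernel t (x 1)‖ ≤ c * t ^ (-(3 / 2 : ℝ)) := by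
      filter_upwards [ae_restrict_mem measurableSet_Ioi] with t ht
      have ht1 : 1 ≤ t := le_of_lt ht
      have ht0 : 0 < t := by linarith
      rw [Real.norm_eq_abs]
      refine (hprod t ht1 (x 0) (x 1)).trans ?_
      have hw := weight_mul_weight_le ht0 ((x 0 : ℤ) : ℝ) ((x 1 : ℤ) : ℝ)
      have hkey := rpow_neg_two_mul_inv_le ht0 hsx
      have h0 : 0 ≤ B * (A + C) := by positivity
      calc B * (A + C) * t ^ (-(2 : ℝ)) *
            (((1 + ((x 0 : ℤ) : ℝ) ^ 2 / t) ^ 1)⁻¹ * ((1 + ((x 1 : ℤ) : ℝ) ^ 2 / t) ^ 1)⁻¹)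
          ≤ B * (A + C) * t ^ (-(2 : ℝ)) * (1 + s x / t)⁻¹ := by gcongr
        _ = B * (A + C) * (t ^ (-(2 : ℝ)) * (1 + s x / t)⁻¹) := by ring
        _ ≤ B * (A + C) * (t ^ (-(3 / 2 : ℝ)) / (2 * Real.sqrt (s x))) := by gcongr
        _ = c * t ^ (-(3 / 2 : ℝ)) := by rw [hc]; ring
    calc |I₂ x| = ‖∫ t in Ioi (1 : ℝ), (srwHeatKernel t (x 0) * srwHeatKernel t (x 1) - gaussHeatKernel t (x 0) * gaussHeatKernel t (x 1))‖ :=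
          (Real.norm_eq_abs _).symm
      _ ≤ ∫ t in Ioi (1 : ℝ), c * t ^ (-(3 / 2 : ℝ)) :=
          norm_integral_le_of_norm_le (hrpow32.const_mul c) hb
      _ = c * 2 := by rw [integral_const_mul, hval32]
      _ = B * (A + C) / Real.sqrt (s x) := by rw [hc]; field_simp
  -- the rate at points with `s x ≥ 2`
  set K : ℝ := A ^ 2 + B * (A + C) + (2 * π)⁻¹ * 2 with hK
  have hK0 : 0 ≤ K := by positivity
  have hrate : ∀ x : Site 2, 2 ≤ s x →
      |latticePotentialKernel 2 x - (2 * π)⁻¹ * Real.log (s x) - κ| ≤ K / Real.sqrt (s x) := by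
    intro x hsx2
    have hx : x ≠ 0 := by
      rintro rfl
      have h0 : s 0 = 0 := by simp [hs]
      linarith
    have hsx : 0 < s x := by linarith
    have hsq : 0 < Real.sqrt (s x) := Real.sqrt_pos.2 hsx
    have hsq1 : 1 ≤ Real.sqrt (s x) := by
      rw [show (1 : ℝ) = Real.sqrt 1 from Real.sqrt_one.symm]
      exact Real.sqrt_le_sqrt (by linarith)
    have hsqle : Real.sqrt (s x) ≤ s x := by
      have h := Real.sq_sqrt hsx.le
      nlinarith
    rw [hdecomp x hx]
    obtain ⟨hl0, hl1⟩ := logIntegral_sub_log_sub_const (σ := s x / 2) (by linarith)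
    have e : (C₀ - I₁ x) + (C₁ - I₂ x) + (2 * π)⁻¹ * (logIntegral (s x / 2) - Real.log (s x / 2)) -
        (2 * π)⁻¹ * Real.log 2 - κ =
        -I₁ x - I₂ x + (2 * π)⁻¹ * (logIntegral (s x / 2) - Real.log (s x / 2) - logIntegralConst) := by
      simp only [hκ]; ring
    rw [e]
    have h1 : |I₁ x| ≤ A ^ 2 / Real.sqrt (s x) := by
      refine (hI₁ x).trans ?_
      rw [div_eq_mul_inv]
      refine mul_le_mul_of_nonneg_left ?_ (by positivity)
      exact inv_anti₀ hsq (by linarith)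
    have h2 := hI₂ x hx
    have h3 : |(2 * π)⁻¹ * (logIntegral (s x / 2) - Real.log (s x / 2) - logIntegralConst)| ≤
        (2 * π)⁻¹ * 2 / Real.sqrt (s x) := by
      rw [abs_mul, abs_of_pos (by positivity : (0 : ℝ) < (2 * π)⁻¹), abs_of_nonneg hl0, mul_div_assoc]
      gcongr
      calc logIntegral (s x / 2) - Real.log (s x / 2) - logIntegralConst ≤ (s x / 2)⁻¹ := hl1
        _ = 2 / s x := by rw [inv_div]
        _ ≤ 2 / Real.sqrt (s x) := by gcongr
    calc |-I₁ x - I₂ x + (2 * π)⁻¹ * (logIntegral (s x / 2) - Real.log (s x / 2) - logIntegralConst)|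
        ≤ |-I₁ x - I₂ x| + |(2 * π)⁻¹ * (logIntegral (s x / 2) - Real.log (s x / 2) - logIntegralConst)| :=
          abs_add_le _ _
      _ ≤ (|I₁ x| + |I₂ x|) + (2 * π)⁻¹ * 2 / Real.sqrt (s x) := by
          gcongr
          calc |-I₁ x - I₂ x| = |-(I₁ x + I₂ x)| := by ring_nf
            _ = |I₁ x + I₂ x| := abs_neg _
            _ ≤ |I₁ x| + |I₂ x| := abs_add_le _ _
      _ ≤ (A ^ 2 / Real.sqrt (s x) + B * (A + C) / Real.sqrt (s x)) + (2 * π)⁻¹ * 2 / Real.sqrt (s x) := by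
          gcongr
      _ = K / Real.sqrt (s x) := by simp only [hK]; field_simp
  -- identify `κ = k₀/2` by uniqueness of the limit
  have hκeq : κ = KozdronLawler.greenConst / 2 := by
    have hlim1 := latticePotentialKernel_two_tendsto_greenConst
    have hlim2 : Tendsto (fun x : Site 2 => latticePotentialKernel 2 x -
        (2 * π)⁻¹ * Real.log (((x 0 : ℤ) : ℝ) ^ 2 + ((x 1 : ℤ) : ℝ) ^ 2)) cofinite (𝓝 κ) := by
      rw [tendsto_iff_norm_sub_tendsto_zero]
      have hmaj : Tendsto (fun x => K / Real.sqrt (s x)) cofinite (𝓝 0) := by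
        have h1 : Tendsto (fun x => Real.sqrt (s x)) cofinite atTop :=
          Real.tendsto_sqrt_atTop.comp hstend
        have h2 := h1.inv_tendsto_atTop.const_mul K
        rw [mul_zero] at h2
        exact h2.congr fun x => (div_eq_mul_inv _ _).symm
      refine squeeze_zero_norm' ?_ hmaj
      filter_upwards [hstend.eventually (eventually_ge_atTop 2)] with x hx
      rw [Real.norm_eq_abs, Real.norm_eq_abs, abs_abs]
      exact hrate x hx
    exact tendsto_nhds_unique hlim2 hlim1
  -- the finitely many exceptional points `x ≠ 0` with `s x < 2`
  have hfin : Set.Finite {x : Site 2 | s x < 2} := by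
    have h : {x : Site 2 | 2 ≤ s x} ∈ cofinite := hstend.eventually (eventually_ge_atTop 2)
    rw [mem_cofinite] at h
    refine h.subset fun x hx => ?_
    simp only [mem_compl_iff, mem_setOf_eq, not_le]
    exact hx
  obtain ⟨M, hM⟩ := (hfin.image fun x => |latticePotentialKernel 2 x -
      1 / π * Real.log ‖Site.toComplex x‖ - KozdronLawler.greenConst / 2| * ‖Site.toComplex x‖).bddAbove
  refine ⟨max K M, fun x hx => ?_⟩
  have hsx1 := hs1 x hx
  have hnorm : 0 < ‖Site.toComplex x‖ := by
    rw [← hsqrt]; exact Real.sqrt_pos.2 (by linarith)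
  -- the centring terms agree: `(2π)⁻¹ log s = (1/π) log ‖x‖`
  have hcentre : (2 * π)⁻¹ * Real.log (s x) = 1 / π * Real.log ‖Site.toComplex x‖ := by
    rw [hsnorm, Real.log_pow]
    push_cast
    field_simp
  by_cases h2 : 2 ≤ s x
  · have h := hrate x h2
    rw [hcentre, hκeq, hsqrt] at h
    exact h.trans (div_le_div_of_nonneg_right (le_max_left _ _) hnorm.le)
  · push Not at h2
    have hmem : |latticePotentialKernel 2 x - 1 / π * Real.log ‖Site.toComplex x‖ - KozdronLawler.greenConst / 2| *
        ‖Site.toComplex x‖ ∈ (fun x => |latticePotentialKernel 2 x -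
          1 / π * Real.log ‖Site.toComplex x‖ - KozdronLawler.greenConst / 2| * ‖Site.toComplex x‖) ''
          {x : Site 2 | s x < 2} := ⟨x, h2, rfl⟩
    have hle := hM hmem
    rw [le_div_iff₀ hnorm]
    exact hle.trans (le_max_right _ _)

end Literature.Probability.LatticeModels

end
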